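import Literature.MathematicalPhysics.QuantumLattice.ClusterProductStateDensityStraddle
import Literature.MathematicalPhysics.QuantumLattice.HubbardTTPrimeMeanEnergyMinimisers
import Literature.MathematicalPhysics.QuantumLattice.InfVolFermionStateCorrelationPositiveDefinite
import HarnessLib

/-!
# The open-cluster cap of the extended `t–t'–U–V` Hubbard model in infinite volume: translation covariance and range of the nearest-neighbour repulsion,
# and `e_{ρ̄}(t,t',U,V) ≤ (Re tr(H^{open}_{cell} ρ₀) + V·Σ_{boundary bonds} ½ β β)/|C|` — the V energy of the cluster product state EXACTLY

Topic `Literature/MathematicalPhysics/QuantumLattice` (family `hubbard`; §1 general `d`, §2 on `ℤ²`). Completes `ClusterProductStateDensityStraddle` (hubbard-box-p3 g15):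
the translation covariance and finite range of `nnRepulsionFermionInteraction` / `hubbardTT'VFermionInteraction` (Schüler et al. 2013 eq. (1)) were not in the
tree; with them the cluster variational principle with straddle correction specialises to the `t–t'–U–V` model, whose hopping straddlers vanish
(`rectTilingState_expect_hubbardTTPrime_eq_zero_of_straddle`) and whose density–density straddlers are enumerated (`straddleSum_nnRepulsion_eq`) and
factorised (`rectTilingState_expect_nnRepulsion_pair_eq`): **`tiGroundEnergyDensityAt_hubbardTT'V_le_of_rectTilingState`**. For the material-oracle boxes that
carry `V/t` (NdNiO₂ object M: `[0.49, 0.67]`) this replaces the kinematic cap allowance `+V(2ρ+ρ²)` / `+V·2(ρ+2D)` of `HubbardTTPrimeNNRepulsionTransport` by the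
trial state's own V energy (python preview on hubbard-box-p2's 2 × 4 vectors: `1.49 V` per site at `ρ = 7/8`, vs `2.52 V`).

Everything is PROVED; no definition, no named fact, no number, no `sorry`.

## Tree / Mathlib search

REUSED: `nnRepulsionFermionInteraction(_apply_pair/_apply_eq_zero/_apply_singleton)`, `hubbardTT'VFermionInteraction(_apply)` (`HubbardNNRepulsionInteraction`);
`shiftSet_pair_eq`, `eq_pair_of_shiftSet_eq`, `diam_coe_pair_add`, `norm_unitVec_site`, `hubbardTTPrimeFermionInteraction_isTranslationInvariant/_hasFiniteRange`
(`HubbardTTPrimeMeanEnergyMinimisers`); `fermionEmbed_shiftEmb_nAt` (`InfVolFermionStateCorrelationPositiveDefinite`); `FermionInteraction.isTranslationInvariant_pencil`,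
`hasFiniteRange_pencil` (`TIGroundEnergyDensityResponse`); `tiGroundEnergyDensityAt_le_of_rectTilingState_add_straddle`, `straddleSum_nnRepulsion_eq`,
`rectTilingState_expect_hubbardTTPrime_eq_zero_of_straddle`, `hubbardTTPrimeFermionInteraction_apply_empty` (`ClusterProductState*`).

## References

* M. Schüler et al., PRL 111 (2013) 036601, eq. (1). [cite: SchulerEtAl2013, Eq. (1)]
* D. Ruelle, *Statistical Mechanics: Rigorous Results* (1969), §3.3. [cite: Ruelle1969, §3.3]
* H. Araki, H. Moriya, Rev. Math. Phys. 15 (2003) 93, §5.4, §8. [cite: ArakiMoriya2003, §5.4 (finite range potentials)]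
-/

noncomputable section

namespace Literature.MathematicalPhysics.QuantumLattice

open Matrix Finset HubbardWave0 Literature.Probability.LatticeModels ThermodynamicLimit
open scoped ComplexOrder BigOperators

variable {d : ℕ}

/-! ### §1. Translation covariance and range of the nearest-neighbour repulsion -/

/-- Bond term of the repulsion at a region known to be a bond `S = {y, z}`, `z = y + e_i`. [cite: SchulerEtAl2013, Eq. (1)] -/
theorem nnRepulsionFermionInteraction_apply_of_eq_pair (V : ℝ) {S : Finset (Site d)} {y z : Site d} {i : Fin d}
    (hS : S = {y, z}) (hz : z = y + unitVec i) (hy : y ∈ S) (hz' : z ∈ S) :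
    (nnRepulsionFermionInteraction d V).Φ S =
      (V : ℂ) • ((nAt y hy 0 + nAt y hy 1) * (nAt z hz' 0 + nAt z hz' 1)) := by
  subst hz; subst hS
  exact nnRepulsionFermionInteraction_apply_pair V y i

/-- **The nearest-neighbour repulsion is translation invariant**: `Φ_V(X + w) = Γ(τ_w)(Φ_V X)`. [cite: ArakiMoriya2003, §1 assumption (IV) and §8] -/
theorem nnRepulsionFermionInteraction_isTranslationInvariant (V : ℝ) :
    (nnRepulsionFermionInteraction d V).IsTranslationInvariant := by
  intro w X
  by_cases h2 : ∃ (x : Site d) (i : Fin d), X = {x, x + unitVec i}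
  · obtain ⟨x, i, rfl⟩ := h2
    rw [nnRepulsionFermionInteraction_apply_of_eq_pair V (shiftSet_pair_eq w x (x + unitVec i))
        (add_right_comm x (unitVec i) w) (PolySite.add_mem_shiftSet w (Finset.mem_insert_self _ _))
        (PolySite.add_mem_shiftSet w (Finset.mem_insert_of_mem (Finset.mem_singleton_self _))),
      nnRepulsionFermionInteraction_apply_pair, map_smul]
    simp only [map_add, map_mul, InfVolFermionState.fermionEmbed_shiftEmb_nAt]
  have hX : (nnRepulsionFermionInteraction d V).Φ X = 0 :=
    nnRepulsionFermionInteraction_apply_eq_zero V fun x i hx => h2 ⟨x, i, hx⟩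
  have hS : (nnRepulsionFermionInteraction d V).Φ (shiftSet w X) = 0 := by
    refine nnRepulsionFermionInteraction_apply_eq_zero V fun y i hy => h2 ⟨y - w, i, ?_⟩
    rw [eq_pair_of_shiftSet_eq hy, add_sub_right_comm]
  rw [hX, hS, map_zero]

/-- **The nearest-neighbour repulsion has range `1`.** [cite: ArakiMoriya2003, §5.4 (finite range potentials)] -/
theorem nnRepulsionFermionInteraction_hasFiniteRange (V : ℝ) : (nnRepulsionFermionInteraction d V).HasFiniteRange 1 := by
  intro X hX
  refine nnRepulsionFermionInteraction_apply_eq_zero V fun x i hx => ?_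
  subst hx
  rw [diam_coe_pair_add, norm_unitVec_site] at hX
  exact lt_irrefl _ hX

/-- **The extended `t–t'–U–V` interaction is translation invariant.** [cite: SchulerEtAl2013, Eq. (1)] -/
theorem hubbardTT'VFermionInteraction_isTranslationInvariant (t t' U V : ℝ) :
    (hubbardTT'VFermionInteraction t t' U V).IsTranslationInvariant :=
  FermionInteraction.isTranslationInvariant_pencil (hubbardTTPrimeFermionInteraction_isTranslationInvariant t t' U)
    (nnRepulsionFermionInteraction_isTranslationInvariant 1) V

/-- **The extended `t–t'–U–V` interaction has range `1`.** [cite: SchulerEtAl2013, Eq. (1)] -/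
theorem hubbardTT'VFermionInteraction_hasFiniteRange (t t' U V : ℝ) :
    (hubbardTT'VFermionInteraction t t' U V).HasFiniteRange 1 :=
  FermionInteraction.hasFiniteRange_pencil (hubbardTTPrimeFermionInteraction_hasFiniteRange t t' U)
    (nnRepulsionFermionInteraction_hasFiniteRange 1) V

/-- The extended interaction has no vacuum term. [cite: SchulerEtAl2013, Eq. (1)] -/
theorem hubbardTT'VFermionInteraction_apply_empty (t t' U V : ℝ) : (hubbardTT'VFermionInteraction t t' U V).Φ ∅ = 0 := by
  rw [hubbardTT'VFermionInteraction_apply, InfVolFermionState.hubbardTTPrimeFermionInteraction_apply_empty,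
    nnRepulsionFermionInteraction_apply_eq_zero V (fun x i h => Finset.insert_ne_empty _ _ h.symm), add_zero]

/-! ### §2. The `t–t'–U–V` cluster cap with the exact straddle term -/

namespace InfVolFermionState

/-- **THE OPEN-CLUSTER CAP OF THE EXTENDED `t–t'–U–V` MODEL (infinite volume).** For every even density matrix `ρ₀` on the open `(q₀+1) × (q₁+1)` box and every
range parameter `R ≥ 1`: the translation-invariant variational energy density at the cluster's mean filling is at most the cluster's free-boundary energy PLUS the
straddle sum, which for this model is carried by the nearest-neighbour density–density bonds with exactly one endpoint in the cell (weight `1/2` each; hopping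
straddlers vanish): `e_{ρ̄}(t,t',U,V; R) ≤ |C|⁻¹·Re(tr(H^{ttUV}_{cell} ρ₀) + Σ_{x ∈ T, i : x+e_i ∈ T} [exactly one of x, x+e_i in the cell]·½·ω(Φ_V{x,x+e_i}))`, `T = thicken_R cell`,
each surviving term factorising into two site densities of `ρ₀` (`rectTilingState_expect_nnRepulsion_pair_eq`). [cite: Ruelle1969, §3.3] [cite: SchulerEtAl2013, Eq. (1)] -/
theorem tiGroundEnergyDensityAt_hubbardTT'V_le_of_rectTilingState (q : Fin 2 → ℕ) (ρ₀ : FermionOp (halfOpenRect q))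
    (hev : parityAut ρ₀ = ρ₀) (hpsd : ρ₀.PosSemidef) (htr : ρ₀.trace = 1) (t t' U V : ℝ) {R : ℝ} (hR : 1 ≤ R) :
    (hubbardTT'VFermionInteraction t t' U V).tiGroundEnergyDensityAt R
        ((Fintype.card (Cell q) : ℝ)⁻¹ * ((totalNumber : FermionOp (halfOpenRect q)) * ρ₀).trace.re) ≤
      (Fintype.card (Cell q) : ℝ)⁻¹ *
        (((hubbardTT'VFermionInteraction t t' U V).localHamiltonian (halfOpenRect q) * ρ₀).trace +
          ∑ p ∈ ((thicken (halfOpenRect q) R) ×ˢ (univ : Finset (Fin 2))) with p.1 + unitVec p.2 ∈ thicken (halfOpenRect q) R,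
            if (p.1 ∈ halfOpenRect q ∧ p.1 + unitVec p.2 ∉ halfOpenRect q) ∨ (p.1 ∉ halfOpenRect q ∧ p.1 + unitVec p.2 ∈ halfOpenRect q) then
              (1 / 2 : ℂ) * (rectTilingState q ρ₀ hev hpsd htr).expect {p.1, p.1 + unitVec p.2}
                ((nnRepulsionFermionInteraction 2 V).Φ {p.1, p.1 + unitVec p.2})
            else 0).re := by
  have h := tiGroundEnergyDensityAt_le_of_rectTilingState_add_straddle q ρ₀ hev hpsd htr
    (hubbardTT'VFermionInteraction_isTranslationInvariant t t' U V) ((hubbardTT'VFermionInteraction_hasFiniteRange t t' U V).of_le hR)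
  rw [hubbardTT'VFermionInteraction_apply_empty, map_zero, sub_zero] at h
  refine h.trans (le_of_eq ?_)
  congr 2
  congr 1
  -- the straddle sum: hopping part vanishes term by term, the repulsion part is enumerated (`straddleSum_nnRepulsion_eq`, restated inline so that
  -- this file elaborates against either build of its import)
  classical
  have hw : ∀ (C : Finset (Site 2)) (x : Site 2) (i : Fin 2), ¬ ({x, x + unitVec i} : Finset (Site 2)) ⊆ C →
      ((({x, x + unitVec i} : Finset (Site 2)) ∩ C).card : ℂ) * ((({x, x + unitVec i} : Finset (Site 2)).card : ℂ)⁻¹) =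
        if (x ∈ C ∧ x + unitVec i ∉ C) ∨ (x ∉ C ∧ x + unitVec i ∈ C) then (1 / 2 : ℂ) else 0 := by
    intro C x i h
    have hne : x ≠ x + unitVec i := self_ne_add_unitVec x i
    rw [Finset.card_pair hne]
    by_cases hx : x ∈ C
    · have hy : x + unitVec i ∉ C := fun hy => h (Finset.insert_subset hx (Finset.singleton_subset_iff.2 hy))
      have hI : ({x, x + unitVec i} : Finset (Site 2)) ∩ C = {x} := by
        ext z; simp only [Finset.mem_inter, Finset.mem_insert, Finset.mem_singleton]
        constructor
        · rintro ⟨hz | hz, hzC⟩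
          · exact hz
          · exact absurd (hz ▸ hzC) hy
        · rintro rfl; exact ⟨Or.inl rfl, hx⟩
      rw [hI, Finset.card_singleton, if_pos (Or.inl ⟨hx, hy⟩)]
      push_cast; norm_num
    · by_cases hy : x + unitVec i ∈ C
      · have hI : ({x, x + unitVec i} : Finset (Site 2)) ∩ C = {x + unitVec i} := by
          ext z; simp only [Finset.mem_inter, Finset.mem_insert, Finset.mem_singleton]
          constructor
          · rintro ⟨hz | hz, hzC⟩
            · exact absurd (hz ▸ hzC) hx
            · exact hz
          · rintro rfl; exact ⟨Or.inr rfl, hy⟩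
        rw [hI, Finset.card_singleton, if_pos (Or.inr ⟨hx, hy⟩)]
        push_cast; norm_num
      · have hI : ({x, x + unitVec i} : Finset (Site 2)) ∩ C = ∅ := by
          ext z; simp only [Finset.mem_inter, Finset.mem_insert, Finset.mem_singleton, Finset.notMem_empty, iff_false, not_and]
          rintro (rfl | rfl)
          · exact hx
          · exact hy
        rw [hI, Finset.card_empty, if_neg (fun hh => hh.elim (fun h1 => hx h1.1) (fun h2 => hy h2.2))]
        simp
  have hEnum : ∑ Y ∈ (thicken (halfOpenRect q) R).powerset with ¬ Y ⊆ (halfOpenRect q), ((Y ∩ (halfOpenRect q)).card : ℂ) * ((Y.card : ℂ)⁻¹ * (rectTilingState q ρ₀ hev hpsd htr).expect Y ((nnRepulsionFermionInteraction 2 V).Φ Y)) =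
      ∑ p ∈ ((thicken (halfOpenRect q) R) ×ˢ (univ : Finset (Fin 2))) with p.1 + unitVec p.2 ∈ (thicken (halfOpenRect q) R),
        if (p.1 ∈ (halfOpenRect q) ∧ p.1 + unitVec p.2 ∉ (halfOpenRect q)) ∨ (p.1 ∉ (halfOpenRect q) ∧ p.1 + unitVec p.2 ∈ (halfOpenRect q)) then
          (1 / 2 : ℂ) * (rectTilingState q ρ₀ hev hpsd htr).expect {p.1, p.1 + unitVec p.2} ((nnRepulsionFermionInteraction 2 V).Φ {p.1, p.1 + unitVec p.2})
        else 0 := by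
    rw [Finset.sum_filter]
    rw [sum_powerset_eq_of_hubbard_support (thicken (halfOpenRect q) R)
      (fun Y => if ¬ Y ⊆ (halfOpenRect q) then ((Y ∩ (halfOpenRect q)).card : ℂ) * ((Y.card : ℂ)⁻¹ * (rectTilingState q ρ₀ hev hpsd htr).expect Y ((nnRepulsionFermionInteraction 2 V).Φ Y)) else 0)
      (fun X h1 h2 => by
        by_cases hX : ¬ X ⊆ (halfOpenRect q)
        · rw [if_pos hX, nnRepulsionFermionInteraction_apply_eq_zero V h2, map_zero, mul_zero, mul_zero]
        · rw [if_neg hX])]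
    have h0 : ∑ x ∈ (thicken (halfOpenRect q) R), (if ¬ ({x} : Finset (Site 2)) ⊆ (halfOpenRect q) then
        ((({x} : Finset (Site 2)) ∩ (halfOpenRect q)).card : ℂ) * (((({x} : Finset (Site 2))).card : ℂ)⁻¹ *
          (rectTilingState q ρ₀ hev hpsd htr).expect {x} ((nnRepulsionFermionInteraction 2 V).Φ {x})) else 0) = 0 := by
      refine Finset.sum_eq_zero fun x _ => ?_
      rw [nnRepulsionFermionInteraction_apply_singleton, map_zero, mul_zero, mul_zero, ite_self]
    rw [h0, zero_add]
    refine Finset.sum_congr rfl fun p _ => ?_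
    by_cases hsub : ({p.1, p.1 + unitVec p.2} : Finset (Site 2)) ⊆ (halfOpenRect q)
    · have hx : p.1 ∈ (halfOpenRect q) := hsub (Finset.mem_insert_self _ _)
      have hy : p.1 + unitVec p.2 ∈ (halfOpenRect q) := hsub (Finset.mem_insert_of_mem (Finset.mem_singleton_self _))
      rw [if_neg (not_not.2 hsub), if_neg (fun hh => hh.elim (fun h1 => h1.2 hy) (fun h2 => h2.1 hx))]
    · rw [if_pos hsub, ← mul_assoc, hw (halfOpenRect q) p.1 p.2 hsub]
      split_ifs <;> simp
  rw [← hEnum]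
  refine Finset.sum_congr rfl fun Y hY => ?_
  rw [Finset.mem_filter] at hY
  by_cases hne : (Y ∩ halfOpenRect q).Nonempty
  · rw [hubbardTT'VFermionInteraction_apply, map_add,
      rectTilingState_expect_hubbardTTPrime_eq_zero_of_straddle q ρ₀ hev hpsd htr t t' U hY.2 hne, zero_add]
  · rw [Finset.not_nonempty_iff_eq_empty.1 hne, Finset.card_empty, Nat.cast_zero, zero_mul, zero_mul]

end InfVolFermionState

end Literature.MathematicalPhysics.QuantumLattice

end
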